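import Literature.Topology.FourManifolds.GradientLikeFlow
import Literature.Topology.FourManifolds.ProductCobordismFlow
import HarnessLib

/-!
# Milnor's product theorem (1965, Thm. 3.4): discharge of the integration step and of the theorem

Trunk FourManL.  The tree states Milnor's product theorem as the named fact
`Literature.Topology.FourManifolds.Cobordism.isTrivial_of_isMorseFunction` (`Handles.lean`) and reduces it
(`GradientLike.lean`: `isTrivial_of_isMorseFunction_of_milnor1965`, with the normalised
gradient-like field `ξ(f) = 1` of `exists_contMDiffSection_forall_mlineDeriv_eq_one`;
`GradientLikeFlow.lean`: `Milnor1965_exists_diffeomorph_of_mlineDeriv_eq_one_of_flow`, the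
diffeomorphism `h(y₀, s) = ψ_{y₀}(s)`) to the named fact
`Literature.Topology.FourManifolds.Cobordism.Milnor1965_exists_flow_of_mlineDeriv_eq_one` — existence, uniqueness and joint
smoothness of the level-parametrised integral curves `ψ_y : [0, 1] → W`, `f(ψ_y(s)) = s`, of the
printed proof (Milnor, *Lectures on the h-cobordism theorem* (1965), pp. 22–23).  That fact is
**proved** here (`Milnor1965_exists_flow_of_mlineDeriv_eq_one_holds`) from the chart-free flow
theorem `Literature.Topology.FourManifolds.IsNormalizedPair.exists_levelFlow` of `ProductCobordismFlow.lean` (a Morse function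
on a cobordism without critical points together with `ξ` is a normalised pair: `f ∈ {0, 1}` on
`∂W = inl M ⊔ inr N`, `0 < f < 1` inside), and with it the two downstream facts:
`Milnor1965_exists_diffeomorph_of_mlineDeriv_eq_one_holds` and
**`Literature.Topology.FourManifolds.Cobordism.isTrivial_of_isMorseFunction_holds`** — Milnor's Theorem 3.4 is a theorem of the
tree.

## References

* J. Milnor, *Lectures on the h-cobordism theorem*, Princeton (1965), Def. 2.3, Lemma 3.2,
  Thm. 3.4 and its proof (pp. 20–23).
-/

open scoped Manifold ContDiff Topology
open Set Function

noncomputable section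

namespace Literature.Topology.FourManifolds

namespace Cobordism

universe u

variable {n : ℕ} {M N : Type u} [TopologicalSpace M] [ChartedSpace (EuclideanSpace ℝ (Fin n)) M]
  [TopologicalSpace N] [ChartedSpace (EuclideanSpace ℝ (Fin n)) N]

/-- A Morse function on a cobordism (Milnor 1965, Def. 2.3) together with a smooth vector field
`ξ` with `ξ(f) = 1` is a normalised pair in the sense of `Literature.Topology.FourManifolds.IsNormalizedPair`: `f` is `0` on
`inl M` and `1` on `inr N`, which together form `∂W`, and `0 < f < 1` on the interior.
[cite: MilnorHCobordism1965, Def. 2.3 and proof of Thm. 3.4] -/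
theorem IsMorseFunction.isNormalizedPair {c : Cobordism n M N} {f : c.W → ℝ}
    (hf : c.IsMorseFunction f)
    (ξ : Cₛ^∞⟮𝓡∂ (n + 1); EuclideanSpace ℝ (Fin (n + 1)), (TangentSpace (𝓡∂ (n + 1)) : c.W → Type)⟯)
    (hξ : ∀ z, mlineDeriv (𝓡∂ (n + 1)) f z (ξ z) = 1) :
    IsNormalizedPair n f (fun z => ξ z) where
  smooth := hf.isMorse.contMDiff
  smooth_vf := ξ.contMDiff
  deriv_eq_one := hξ
  boundary z hz := by
    have hz' : z ∈ (𝓡∂ (n + 1)).boundary c.W := hz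
    rw [← c.range_inl_union_range_inr] at hz'
    rcases hz' with ⟨x, rfl⟩ | ⟨y, rfl⟩
    · exact Or.inl (hf.2.1 x)
    · exact Or.inr (hf.2.2.1 y)
  interior z hz := hf.2.2.2.2 z hz

/-- **Discharge of `Literature.Topology.FourManifolds.Cobordism.Milnor1965_exists_flow_of_mlineDeriv_eq_one`** (Milnor 1965,
proof of Thm. 3.4, pp. 22–23: existence, uniqueness and joint smoothness of the integral curves
`ψ_y` with `f(ψ_y(s)) = s`).  The level flow of a flow atlas (`Literature.Topology.FourManifolds.FlowAtlas.levelFlow`,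
`ProductCobordismFlow.lean`) has the five listed properties; uniqueness (4) is uniqueness of
integral curves on `[0, 1]` through the common point `y` at time `f y`
(`Literature.Topology.FourManifolds.IsMIntegralCurveOn.eqOn_Icc`). [cite: MilnorHCobordism1965, proof of Thm. 3.4 (pp. 22–23)] -/
theorem Milnor1965_exists_flow_of_mlineDeriv_eq_one_holds :
    Milnor1965_exists_flow_of_mlineDeriv_eq_one (n := n) (M := M) (N := N) := by
  intro c f hf _ ξ hξ
  have h := hf.isNormalizedPair ξ hξ
  obtain ⟨A⟩ := exists_flowAtlas h.smooth_vf
  refine ⟨fun y s => A.levelFlow h y s, fun y => A.isMIntegralCurveOn_levelFlow h y,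
    fun y s hs => A.apply_levelFlow h y hs, fun y => A.levelFlow_apply_self h y,
    fun y γ hγ _ hγy => ?_, A.contMDiffOn_levelFlow h⟩
  exact IsMIntegralCurveOn.eqOn_Icc h.smooth_vf hγ (A.isMIntegralCurveOn_levelFlow h y)
    (hf.mem_Icc y) (hγy.trans (A.levelFlow_apply_self h y).symm)

/-- **Discharge of `Literature.Topology.FourManifolds.Cobordism.Milnor1965_exists_diffeomorph_of_mlineDeriv_eq_one`**
(Milnor 1965, proof of Thm. 3.4: the diffeomorphism `h(y₀, s) = ψ_{y₀}(s)` from the integral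
curves), by `Milnor1965_exists_diffeomorph_of_mlineDeriv_eq_one_of_flow` (`GradientLikeFlow.lean`)
and the flow just proved. [cite: MilnorHCobordism1965, proof of Thm. 3.4 (p. 23)] -/
theorem Milnor1965_exists_diffeomorph_of_mlineDeriv_eq_one_holds :
    Milnor1965_exists_diffeomorph_of_mlineDeriv_eq_one (n := n) (M := M) (N := N) :=
  Milnor1965_exists_diffeomorph_of_mlineDeriv_eq_one_of_flow
    Milnor1965_exists_flow_of_mlineDeriv_eq_one_holds

/-- **Milnor's product theorem (Milnor 1965, Thm. 3.4), discharged.**  A cobordism between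
closed smooth manifolds carrying a Morse function without critical points is a product
cobordism `W ≅ M × [0, 1]` relative to `M`: the tree's fact
`Literature.Topology.FourManifolds.Cobordism.isTrivial_of_isMorseFunction` (`Handles.lean`) holds, by
`isTrivial_of_isMorseFunction_of_milnor1965` (`GradientLike.lean`: Lemma 3.2 with the
normalisation `ξ(f) = 1`, proved there) and the integration step proved above.
[cite: MilnorHCobordism1965, Thm. 3.4] -/
theorem isTrivial_of_isMorseFunction_holds :
    isTrivial_of_isMorseFunction (n := n) (M := M) (N := N) :=
  isTrivial_of_isMorseFunction_of_milnor1965 Milnor1965_exists_diffeomorph_of_mlineDeriv_eq_one_holds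

end Cobordism

end Literature.Topology.FourManifolds
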